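import Literature.Topology.FourManifolds.LatticeFormsDivisorOneOrthogonalDiscriminantForm
import Literature.Topology.FourManifolds.LatticeFormsDiscriminantFormLifting
import Literature.Topology.FourManifolds.LatticeFormsStableOrthogonalGroupIndex
import HarnessLib

/-!
# `O(L, h)/Õ(L, h) ≅ O(q_L)` for a vector `h` of divisor `1` (Gritsenko–Hulek–Sankaran, *Compositio Math.* 146 (2010)
# Prop. 4.12 (ii), split case `f = 1`: "`O(L_{2t}, h_d)/Õ(L_{2t}, h_d) ≅ … ≅ O(⟨k̄₃⟩)`, of order `2^{ρ(t)}`")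

Trunk T-4MAN vocabulary; sequel of `LatticeFormsDivisorOneOrthogonalDiscriminantForm.lean` (row g42-#6: for `(h, h') = 1`,
`D(h^⊥) = p(H) ⊕ K` with `p(H) = ⟨[(h',·)|_{h^⊥}]⟩ ≅ ℤ/(h,h)`, `K = π(ρ(ker ev_h)) ≅ (D(L), q_L)` via
`Φ[ψ] = [(ψ − ψ(h)(h',·))|_{h^⊥}]`, `p(H) ⊥ K`), of `LatticeFormsStableOrthogonalGroupGlueProjection.lean` (row g42-#3,
Lemma 4.2 (iv): the classes of `{γ ∈ O(T) | γ̄|_{p(H)} = id}` modulo `γ̄ = γ̄'` are in bijection with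
`{σ ∈ O(q_T) | σ|_{p(H)} = id}` when `O(T) → O(q_T)` is onto), of `LatticeFormsStableOrthogonalGroupStabiliser.lean`
(row g42-#2, Prop. 4.12 (i) and `{γ ∈ O(h^⊥) | γ̄|_{p(H)} = id} = O(L,h)|_{h^⊥}`), of
`LatticeFormsDiscriminantFormLifting.lean` (Nikulin 1.14.2 / Huybrechts 14.2.4 for lattices with an isotropic vector of
divisor `1`) and of `LatticeFormsStableOrthogonalGroupIndex.lean` (row g39-#3: `|O(q_{L_{2d}})| = 2^{ρ(d)}`). Written for lane `lit-hodgefound` (Track 2 foundations; prover seat `lit-hodgefound-p18`, gen 42, row g42-#7).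
THEOREMS ONLY — no definition, no named fact, no instance, no notation. `O(q)` is typed as elsewhere in the trunk
(`{σ : D ≃ₗ[ℤ] D // ∀ a, q (σ a) = q a}`), classes modulo `Õ` as `Quot (fun γ γ' ↦ γ̄ = γ̄')`.

## Source, verbatim (V. Gritsenko, K. Hulek, G. K. Sankaran, Compositio Math. 146 (2010) 404–434, arXiv numbering
§4, held text `paper:arxiv-0802.2078` p. 12)

"**Proposition 4.12.** Let `h_d ∈ L_{2t}` be a primitive vector such that `h_d² = 2d` and `div(h_d) = f`. Assume that
`w = 1` […] (ii) The factor group `O(L_{2t}, h_d)/Õ(L_{2t}, h_d)` is an abelian `2`-group, which is of order `2^{ρ(t/f)}`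
if `f` is odd. […] *Proof.* […] It follows if `w = 1` the discriminant group is `D(h_d^⊥) = ⟨k̄₁⟩ ⊕ ⟨k̄₃⟩ = p(H) ⊕ ⟨k̄₃⟩`.
According to Lemma 4.2 `O(L_{2t}, h_d) ≅ {γ ∈ O(h_d^⊥) | γ̄|_{p(H)} = id}`. Let us consider an element `γ ∈ O(h_d^⊥)`
satisfying `γ̄|_{p(H)} = id` as an element of `O(L_{2t}, h_d)` […]. According to the decomposition above
`γ ∈ Õ(L_{2t}, h_d)` if and only if `γ̄(k̄₃) = k̄₃`. Therefore `Õ(L_{2t}, h_d) ≅ Õ(h_d^⊥)`. We note that the natural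
projection `O(h_d^⊥) → O(D(L_B))` is surjective (see [Nik]). Therefore according to Lemma 4.2
`O(L_{2t}, h_d)/Õ(L_{2t}, h_d) ≅ {γ ∈ O(h_d^⊥) | γ̄|_{p(H)} = id}/Õ(h_d^⊥) ≅ O(⟨k̄₃⟩)`, where
`⟨k̄₃⟩ = {n k̄₃ | n mod 2t/f}` and `k̄₃² ≡ −f²/2t mod 2`."

## What is here (all proved): the lattice-free form for `f = div(h) = 1`

`B` even nondegenerate symmetric on a finitely generated free `ℤ`-module `M = L`, `h, h' ∈ L` with `(h, h') = 1`,
`(h, h) ≠ 0`, `T = h^⊥`, `p = p_T : L → D(T)`, `p(H) = range p`, `K = π(ρ(ker ev_h)) ⊂ D(T)` (`≅ D(L)`, row g42-#6; for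
`L = L_{2t}` this is `⟨k̄₃⟩ ≅ D(L_{2t})`).

* §1 `p(H) ⊥ K` as subgroups (`discriminantBilin_eq_zero_of_mem_range_toDiscriminantGroup_of_mem`), `q_T(a + k) = q_T(a) + q_T(k)`,
  `b_T` is nondegenerate between `p(H)` and itself modulo `K` (`eq_zero_of_mem_range_toDiscriminantGroup_of_forall_discriminantBilin_eq_zero`),
  and **`K = p(H)^⊥`** (`mem_map_dualMap_subtype_iff_forall_discriminantBilin_eq_zero`).
* §2 An isometry of finite quadratic forms preserves the bilinear forms
  (`discriminantBilin_isometry_of_discriminantQuad`); **a `σ ∈ O(q_T)` with `σ|_{p(H)} = id` maps `K` onto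
  `K`** ("`γ ∈ Õ(L_{2t}, h_d)` iff `γ̄(k̄₃) = k̄₃`": the action on `K` is all that is left;
  `map_eq_of_forall_discriminantQuad_eq_of_forall_apply_toDiscriminantGroup_eq`).
* §3 **`{σ ∈ O(q_T) | σ|_{p(H)} = id} ≅ O(q_K) ≅ O(q_L)`**, as an equality of cardinalities
  (`natCard_discriminantIsometry_apply_toDiscriminantGroup_eq_eq_of_apply_eq_one`: `τ ↦ id_{p(H)} ⊕ ΦτΦ⁻¹`, inverse
  `σ ↦ Φ⁻¹ σ|_K Φ`); hence, when `O(h^⊥) → O(q_{h^⊥})` is onto, **`|O(L,h)|_{h^⊥} / Õ| = |O(q_L)|`**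
  (`natCard_quot_isometryEquiv_toDiscriminantGroup_eq_of_apply_eq_one`, and with the classes indexed by
  `O(L, h)|_{h^⊥} = {γ | ∃ G ∈ O(L), G h = h, G|_{h^⊥} = γ}`: `natCard_quot_exists_isometryEquiv_apply_eq_of_apply_eq_one`);
  the surjectivity holds as soon as `h^⊥` contains an isotropic vector `u` and a `v` with `(u, v) = 1` (Nikulin 1.14.2
  in the form `exists_isometryEquiv_discriminantGroupCongr_eq_of_isotropic`): `…_of_isotropic`.
* §4 **The rank-21 model `2E₈(−1) ⊕ 2U ⊕ ⟨−2t⟩` with the split `h_d = e₁ + d f₁`** (`h_d² = 2d`, `(h_d, f₁) = 1`, the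
  second `U` inside `h_d^⊥`): `|O(L, h_d)|_{h_d^⊥} / Õ| = |O(q_L)| = 2^{ρ(t)}`
  (`natCard_quot_exists_isometryEquiv_apply_eq_latticeL2t_split`; `|O(q)| = 2^{ρ(t)}` is `natCard_discriminantIsometry_latticeL2d`
  of `LatticeFormsStableOrthogonalGroupIndex.lean`, GHS 2007 Lemma 4.3). NOTE ON NOTATION: this rank-21 lattice is the
  `L_{2t}` of GHS 2007 (`= ⟨−2t⟩ ⊕ 2U ⊕ 2E₈(−1)`, the tree's `latticeL2d`), whereas in GHS 2010 `L_{2t} = L_{K3} ⊕ ⟨−2t⟩ =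
  3U ⊕ 2E₈(−1) ⊕ ⟨−2t⟩` has rank 23; the latter is the case `m = 2`, `k = 1` of §5.
* §5 **All models `E₈(−1)^{⊕m} ⊕ U^{⊕(k+2)} ⊕ ⟨−2t⟩`** (GHS 2010's `L_{2t}`: `m = 2`, `k = 1`): `|O(q_{Q ⊕ ⟨−2t⟩})| = 2^{ρ(t)}`
  for every even unimodular `Q` (`natCard_discriminantIsometry_prod_neg_twoMul_smul_mul_of_isUnimodular`), and for the split
  `h_d = e₁ + d f₁`: **`|O(L_{2t}, h_d)|_{h_d^⊥} / Õ| = 2^{ρ(t)}`** (`natCard_quot_exists_isometryEquiv_apply_eq_model_split`) —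
  the printed order `2^{ρ(t/f)}`, `f = 1`.
* Reading notes. (a) The tree has no group structure on `O(T)`/`Õ(T)` in these files, so "abelian `2`-group" is not
  stated; the classes `γ̄ = γ̄'` are the cosets of `Õ(T) = ker(O(T) → O(q_T))` (`discriminantGroupCongr_eq_iff` in
  `LatticeFormsStableOrthogonalGroupIndex.lean`), and `Õ(h^⊥) ≅ Õ(L, h)` is Prop. 4.12 (i)
  (`setOf_discriminantGroupCongr_eq_id_eq_setOf_exists_stable_apply_eq`). (b) Only `f = 1`; for `f > 1` with `w = 1` GHS
  use the explicit basis `k̄₁, k̄₃` of `D(L_B)`, not in the tree. (c) §4–§5 are stated for the representative `e₁ + d f₁`;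
  every split `h_d` is in its `Õ(L_{2t})`-orbit (Example 4.8, `LatticeFormsPolarisationTypesSplitNonsplit.lean`), the
  transport of the count along that isometry is not spelled out here.

## References

* [GritsenkoHulekSankaran2010Symplectic] V. Gritsenko, K. Hulek, G. K. Sankaran, Moduli spaces of irreducible symplectic
  manifolds, Compositio Math. 146 (2010): §4 Lemma 4.2 (iv), Prop. 4.12 (ii) and its proof, Cor. 4.13.
* [GritsenkoHulekSankaran2013ModuliK3] V. Gritsenko, K. Hulek, G. K. Sankaran, Moduli of K3 surfaces and irreducible
  symplectic manifolds, Handbook of Moduli I (2013): §7 Lemma 7.3 (iv).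
* [GritsenkoHulekSankaran2007HM] V. Gritsenko, K. Hulek, G. K. Sankaran, The Hirzebruch–Mumford volume for the orthogonal
  group and applications, Doc. Math. 12 (2007): §4 Lemma 4.3 (`|O(q_{⟨−2d⟩})| = 2^{ρ(d)}`).
* [Nikulin1980] V. V. Nikulin, Integral symmetric bilinear forms and some of their geometric applications, Math. USSR
  Izv. 14 (1980): §1.3, Thm. 1.14.2.
-/

noncomputable section

open Module Function
open LinearMap (BilinForm)
open Literature.Topology.FourManifolds

namespace LinearMap.BilinForm

variable {M : Type*} [AddCommGroup M] (B : BilinForm ℤ M) [Module.Finite ℤ M] [Module.Free ℤ M]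

/-! ### §1 `p(H) ⊥ K`, `K = p(H)^⊥` -/

section Orthogonal

/-- **`p(H) ⊥ K`**: `b_T(a, k) = 0` for `a ∈ p(H)` and `k ∈ K = π(ρ(ker ev_h))` ("Moreover `k̄₁ · k̄₃ = 0`"; `T = h^⊥`,
`(h,h) ≠ 0`, `B` nondegenerate symmetric). [cite: GritsenkoHulekSankaran2010Symplectic, §4 proof of Prop. 4.12] -/
theorem discriminantBilin_eq_zero_of_mem_range_toDiscriminantGroup_of_mem (hBn : B.Nondegenerate) (hB : B.IsSymm)
    {h : M} (hh : B h h ≠ 0) {a k : (B.restrict (B.orthogonal (ℤ ∙ h))).discriminantGroup}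
    (ha : a ∈ LinearMap.range (B.toDiscriminantGroup (B.orthogonal (ℤ ∙ h))))
    (hk : k ∈ (LinearMap.ker (Module.Dual.eval ℤ M h)).map
        ((B.restrict (B.orthogonal (ℤ ∙ h))).discriminantGroupMkQ ∘ₗ (B.orthogonal (ℤ ∙ h)).subtype.dualMap)) :
    (B.restrict (B.orthogonal (ℤ ∙ h))).discriminantBilin (B.nondegenerate_restrict_orthogonal_span_singleton hBn hB hh)
        (hB.restrict _) a k = 0 := by
  obtain ⟨x, rfl⟩ := ha
  obtain ⟨ψ, hψ, rfl⟩ := hk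
  change (Module.Dual.eval ℤ M h) ψ = 0 at hψ
  rw [Module.Dual.eval_apply] at hψ
  rw [LinearMap.comp_apply, discriminantGroupMkQ_apply]
  exact B.discriminantBilin_toDiscriminantGroup_eq_zero_of_apply_eq_zero hBn hB hh x hψ

/-- **`q_T(a + k) = q_T(a) + q_T(k)` for `a ∈ p(H)`, `k ∈ K`** (`L` even; polarisation `q(a+k) = q(a) + q(k) + 2b(a,k)`
and `p(H) ⊥ K`): `q_T = q_{p(H)} ⊕ q_K` on `D(T) = p(H) ⊕ K`.
[cite: GritsenkoHulekSankaran2010Symplectic, §4 proof of Prop. 4.12 ("`D(h_d^⊥) = p(H) ⊕ ⟨k̄₃⟩`")] [cite: Nikulin1980, §1.3] -/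
theorem discriminantQuad_add_of_mem_range_toDiscriminantGroup_of_mem (hBn : B.Nondegenerate) (hB : B.IsSymm)
    (he : B.IsEven) {h : M} (hh : B h h ≠ 0) {a k : (B.restrict (B.orthogonal (ℤ ∙ h))).discriminantGroup}
    (ha : a ∈ LinearMap.range (B.toDiscriminantGroup (B.orthogonal (ℤ ∙ h))))
    (hk : k ∈ (LinearMap.ker (Module.Dual.eval ℤ M h)).map
        ((B.restrict (B.orthogonal (ℤ ∙ h))).discriminantGroupMkQ ∘ₗ (B.orthogonal (ℤ ∙ h)).subtype.dualMap)) :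
    (B.restrict (B.orthogonal (ℤ ∙ h))).discriminantQuad (B.nondegenerate_restrict_orthogonal_span_singleton hBn hB hh)
        (hB.restrict _) (isEven_restrict he _) (a + k) =
      (B.restrict (B.orthogonal (ℤ ∙ h))).discriminantQuad (B.nondegenerate_restrict_orthogonal_span_singleton hBn hB hh)
          (hB.restrict _) (isEven_restrict he _) a +
        (B.restrict (B.orthogonal (ℤ ∙ h))).discriminantQuad (B.nondegenerate_restrict_orthogonal_span_singleton hBn hB hh)
          (hB.restrict _) (isEven_restrict he _) k := by
  rw [discriminantQuad_add, B.discriminantBilin_eq_zero_of_mem_range_toDiscriminantGroup_of_mem hBn hB hh ha hk, map_zero,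
    add_zero]

/-- **`b_T|_{p(H)}` is nondegenerate modulo `K`**: an `a ∈ p(H)` with `b_T(p(x), a) = 0` for all `x ∈ L` is `0` — since
`D(T) = p(H) + K` (`(h,h') = 1`) and `p(H) ⊥ K`, such an `a` is `b_T`-orthogonal to all of `D(T)`, and `b_T` is
nondegenerate. (In GHS's basis: `k̄₁` has order `2d/f = |p(H)|` and `b(k̄₁, k̄₁) = −f²/2d`, a generator of `(1/|p(H)|)ℤ/ℤ`.)
[cite: GritsenkoHulekSankaran2010Symplectic, §4 proof of Prop. 4.12] [cite: Nikulin1980, §1.3 (nondegeneracy of `b_L`)] -/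
theorem eq_zero_of_mem_range_toDiscriminantGroup_of_forall_discriminantBilin_eq_zero (hBn : B.Nondegenerate)
    (hB : B.IsSymm) {h h' : M} (hh : B h h ≠ 0) (hh' : B h h' = 1)
    {a : (B.restrict (B.orthogonal (ℤ ∙ h))).discriminantGroup}
    (ha : a ∈ LinearMap.range (B.toDiscriminantGroup (B.orthogonal (ℤ ∙ h))))
    (h0 : ∀ x : M, (B.restrict (B.orthogonal (ℤ ∙ h))).discriminantBilin
        (B.nondegenerate_restrict_orthogonal_span_singleton hBn hB hh) (hB.restrict _)
        (B.toDiscriminantGroup (B.orthogonal (ℤ ∙ h)) x) a = 0) :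
    a = 0 := by
  refine (B.restrict (B.orthogonal (ℤ ∙ h))).eq_zero_of_forall_discriminantBilin_eq_zero
    (B.nondegenerate_restrict_orthogonal_span_singleton hBn hB hh) (hB.restrict _) fun c ↦ ?_
  have hc : c ∈ LinearMap.range (B.toDiscriminantGroup (B.orthogonal (ℤ ∙ h))) ⊔
      (LinearMap.ker (Module.Dual.eval ℤ M h)).map
        ((B.restrict (B.orthogonal (ℤ ∙ h))).discriminantGroupMkQ ∘ₗ (B.orthogonal (ℤ ∙ h)).subtype.dualMap) := by
    rw [(B.isCompl_range_toDiscriminantGroup_of_apply_eq_one hB hh').sup_eq_top]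
    exact Submodule.mem_top
  obtain ⟨a₂, ⟨x₂, rfl⟩, k₂, hk₂, rfl⟩ := Submodule.mem_sup.1 hc
  rw [map_add, (B.restrict (B.orthogonal (ℤ ∙ h))).discriminantBilin_comm _ _ a
      (B.toDiscriminantGroup (B.orthogonal (ℤ ∙ h)) x₂), h0 x₂, zero_add]
  exact B.discriminantBilin_eq_zero_of_mem_range_toDiscriminantGroup_of_mem hBn hB hh ha hk₂

/-- **`K = p(H)^⊥`** in `(D(h^⊥), b)` for `(h, h') = 1`: `k ∈ K ⟺ b_T(p(x), k) = 0` for all `x ∈ L` — `⊆` is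
`p(H) ⊥ K`; conversely write `k = a + k'` along `D(T) = p(H) ⊕ K`, then `a ∈ p(H)` is orthogonal to `p(H)`, hence `a = 0`.
("`D(h_d^⊥) = ⟨k̄₁⟩ ⊕ ⟨k̄₃⟩`, `k̄₁ · k̄₃ = 0`": the second summand is the orthogonal complement of the first.)
[cite: GritsenkoHulekSankaran2010Symplectic, §4 proof of Prop. 4.12] -/
theorem mem_map_dualMap_subtype_iff_forall_discriminantBilin_eq_zero (hBn : B.Nondegenerate) (hB : B.IsSymm)
    {h h' : M} (hh : B h h ≠ 0) (hh' : B h h' = 1) (k : (B.restrict (B.orthogonal (ℤ ∙ h))).discriminantGroup) :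
    k ∈ (LinearMap.ker (Module.Dual.eval ℤ M h)).map
        ((B.restrict (B.orthogonal (ℤ ∙ h))).discriminantGroupMkQ ∘ₗ (B.orthogonal (ℤ ∙ h)).subtype.dualMap) ↔
      ∀ x : M, (B.restrict (B.orthogonal (ℤ ∙ h))).discriminantBilin
        (B.nondegenerate_restrict_orthogonal_span_singleton hBn hB hh) (hB.restrict _)
        (B.toDiscriminantGroup (B.orthogonal (ℤ ∙ h)) x) k = 0 := by
  refine ⟨fun hk x ↦ B.discriminantBilin_eq_zero_of_mem_range_toDiscriminantGroup_of_mem hBn hB hh ⟨x, rfl⟩ hk,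
    fun h0 ↦ ?_⟩
  have hk : k ∈ LinearMap.range (B.toDiscriminantGroup (B.orthogonal (ℤ ∙ h))) ⊔
      (LinearMap.ker (Module.Dual.eval ℤ M h)).map
        ((B.restrict (B.orthogonal (ℤ ∙ h))).discriminantGroupMkQ ∘ₗ (B.orthogonal (ℤ ∙ h)).subtype.dualMap) := by
    rw [(B.isCompl_range_toDiscriminantGroup_of_apply_eq_one hB hh').sup_eq_top]
    exact Submodule.mem_top
  obtain ⟨a, ha, k', hk', rfl⟩ := Submodule.mem_sup.1 hk
  have ha0 : a = 0 := by
    refine B.eq_zero_of_mem_range_toDiscriminantGroup_of_forall_discriminantBilin_eq_zero hBn hB hh hh' ha fun x ↦ ?_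
    have h1 := h0 x
    rwa [map_add, B.discriminantBilin_eq_zero_of_mem_range_toDiscriminantGroup_of_mem hBn hB hh ⟨x, rfl⟩ hk',
      add_zero] at h1
  rw [ha0, zero_add]
  exact hk'

end Orthogonal

/-! ### §2 Isometries of `q_T` fixing `p(H)` preserve `K` -/

section Stable

/-- **An isometry for `q` is an isometry for `b`**: `q₂(e a) = q₁(a)` for all `a` implies `b₂(e a, e c) = b₁(a, c)`, by
polarisation `b = ½ (q(a + c) − q(a) − q(c))` (companion of `discriminantBilin_antiIsometry_of_discriminantQuad`).
[cite: Nikulin1980, §1.3 ("the bilinear form of `q`")] -/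
theorem discriminantBilin_isometry_of_discriminantQuad {P₁ P₂ : Type*} [AddCommGroup P₁] [AddCommGroup P₂]
    [Module.Finite ℤ P₁] [Module.Free ℤ P₁] [Module.Finite ℤ P₂] [Module.Free ℤ P₂] {B₁ : BilinForm ℤ P₁}
    {B₂ : BilinForm ℤ P₂} (h₁ : B₁.Nondegenerate) (hs₁ : B₁.IsSymm) (he₁ : B₁.IsEven) (h₂ : B₂.Nondegenerate)
    (hs₂ : B₂.IsSymm) (he₂ : B₂.IsEven) (e : B₁.discriminantGroup ≃ₗ[ℤ] B₂.discriminantGroup)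
    (hq : ∀ a, B₂.discriminantQuad h₂ hs₂ he₂ (e a) = B₁.discriminantQuad h₁ hs₁ he₁ a)
    (a c : B₁.discriminantGroup) :
    B₂.discriminantBilin h₂ hs₂ (e a) (e c) = B₁.discriminantBilin h₁ hs₁ a c := by
  rw [discriminantBilin_eq_equivAddCircle_symm B₂ h₂ hs₂ he₂, discriminantBilin_eq_equivAddCircle_symm B₁ h₁ hs₁ he₁,
    ← map_add e, hq, hq, hq]

/-- **An isometry `σ ∈ O(q_T)` with `σ|_{p(H)} = id` maps `K` into `K`** (`(h,h') = 1`, `L` even): `K = p(H)^⊥` and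
`b_T(p(x), σ k) = b_T(σ p(x), σ k) = b_T(p(x), k) = 0`. ("According to the decomposition above `γ ∈ Õ(L_{2t}, h_d)` if and
only if `γ̄(k̄₃) = k̄₃`": `γ̄` acts on the summand `⟨k̄₃⟩`.) [cite: GritsenkoHulekSankaran2010Symplectic, §4 proof of Prop. 4.12] -/
theorem map_mem_of_forall_discriminantQuad_eq_of_forall_apply_toDiscriminantGroup_eq (hBn : B.Nondegenerate)
    (hB : B.IsSymm) (he : B.IsEven) {h h' : M} (hh : B h h ≠ 0) (hh' : B h h' = 1)
    (σ : (B.restrict (B.orthogonal (ℤ ∙ h))).discriminantGroup ≃ₗ[ℤ] (B.restrict (B.orthogonal (ℤ ∙ h))).discriminantGroup)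
    (hσq : ∀ a, (B.restrict (B.orthogonal (ℤ ∙ h))).discriminantQuad
        (B.nondegenerate_restrict_orthogonal_span_singleton hBn hB hh) (hB.restrict _) (isEven_restrict he _) (σ a) =
      (B.restrict (B.orthogonal (ℤ ∙ h))).discriminantQuad
        (B.nondegenerate_restrict_orthogonal_span_singleton hBn hB hh) (hB.restrict _) (isEven_restrict he _) a)
    (hσp : ∀ x : M, σ (B.toDiscriminantGroup (B.orthogonal (ℤ ∙ h)) x) = B.toDiscriminantGroup (B.orthogonal (ℤ ∙ h)) x)
    {k : (B.restrict (B.orthogonal (ℤ ∙ h))).discriminantGroup}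
    (hk : k ∈ (LinearMap.ker (Module.Dual.eval ℤ M h)).map
        ((B.restrict (B.orthogonal (ℤ ∙ h))).discriminantGroupMkQ ∘ₗ (B.orthogonal (ℤ ∙ h)).subtype.dualMap)) :
    σ k ∈ (LinearMap.ker (Module.Dual.eval ℤ M h)).map
        ((B.restrict (B.orthogonal (ℤ ∙ h))).discriminantGroupMkQ ∘ₗ (B.orthogonal (ℤ ∙ h)).subtype.dualMap) := by
  rw [B.mem_map_dualMap_subtype_iff_forall_discriminantBilin_eq_zero hBn hB hh hh']
  intro x
  rw [← hσp x, discriminantBilin_isometry_of_discriminantQuad _ _ (isEven_restrict he _) _ _ (isEven_restrict he _) σ hσq]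
  exact B.discriminantBilin_eq_zero_of_mem_range_toDiscriminantGroup_of_mem hBn hB hh ⟨x, rfl⟩ hk

/-- **`σ(K) = K`** for `σ ∈ O(q_T)` with `σ|_{p(H)} = id` (`(h,h') = 1`, `L` even): `σ` and `σ⁻¹` both map `K` into `K`.
[cite: GritsenkoHulekSankaran2010Symplectic, §4 proof of Prop. 4.12] -/
theorem map_eq_of_forall_discriminantQuad_eq_of_forall_apply_toDiscriminantGroup_eq (hBn : B.Nondegenerate)
    (hB : B.IsSymm) (he : B.IsEven) {h h' : M} (hh : B h h ≠ 0) (hh' : B h h' = 1)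
    (σ : (B.restrict (B.orthogonal (ℤ ∙ h))).discriminantGroup ≃ₗ[ℤ] (B.restrict (B.orthogonal (ℤ ∙ h))).discriminantGroup)
    (hσq : ∀ a, (B.restrict (B.orthogonal (ℤ ∙ h))).discriminantQuad
        (B.nondegenerate_restrict_orthogonal_span_singleton hBn hB hh) (hB.restrict _) (isEven_restrict he _) (σ a) =
      (B.restrict (B.orthogonal (ℤ ∙ h))).discriminantQuad
        (B.nondegenerate_restrict_orthogonal_span_singleton hBn hB hh) (hB.restrict _) (isEven_restrict he _) a)
    (hσp : ∀ x : M, σ (B.toDiscriminantGroup (B.orthogonal (ℤ ∙ h)) x) = B.toDiscriminantGroup (B.orthogonal (ℤ ∙ h)) x) :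
    ((LinearMap.ker (Module.Dual.eval ℤ M h)).map
        ((B.restrict (B.orthogonal (ℤ ∙ h))).discriminantGroupMkQ ∘ₗ (B.orthogonal (ℤ ∙ h)).subtype.dualMap)).map
        (σ : (B.restrict (B.orthogonal (ℤ ∙ h))).discriminantGroup →ₗ[ℤ] (B.restrict (B.orthogonal (ℤ ∙ h))).discriminantGroup) =
      (LinearMap.ker (Module.Dual.eval ℤ M h)).map
        ((B.restrict (B.orthogonal (ℤ ∙ h))).discriminantGroupMkQ ∘ₗ (B.orthogonal (ℤ ∙ h)).subtype.dualMap) := by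
  have hσ'q : ∀ a, (B.restrict (B.orthogonal (ℤ ∙ h))).discriminantQuad
        (B.nondegenerate_restrict_orthogonal_span_singleton hBn hB hh) (hB.restrict _) (isEven_restrict he _) (σ.symm a) =
      (B.restrict (B.orthogonal (ℤ ∙ h))).discriminantQuad
        (B.nondegenerate_restrict_orthogonal_span_singleton hBn hB hh) (hB.restrict _) (isEven_restrict he _) a :=
    fun a ↦ by rw [← hσq, LinearEquiv.apply_symm_apply]
  have hσ'p : ∀ x : M, σ.symm (B.toDiscriminantGroup (B.orthogonal (ℤ ∙ h)) x) =
      B.toDiscriminantGroup (B.orthogonal (ℤ ∙ h)) x := fun x ↦ by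
    rw [LinearEquiv.symm_apply_eq, hσp]
  refine le_antisymm ?_ fun k hk ↦ ?_
  · rintro _ ⟨k, hk, rfl⟩
    exact B.map_mem_of_forall_discriminantQuad_eq_of_forall_apply_toDiscriminantGroup_eq hBn hB he hh hh' σ hσq hσp hk
  · exact ⟨σ.symm k, B.map_mem_of_forall_discriminantQuad_eq_of_forall_apply_toDiscriminantGroup_eq hBn hB he hh hh'
      σ.symm hσ'q hσ'p hk, σ.apply_symm_apply k⟩

end Stable

/-! ### §3 `{σ ∈ O(q_T) | σ|_{p(H)} = id} ≅ O(q_L)` and `|O(L,h)/Õ(L,h)| = |O(q_L)|` -/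

section Count

set_option maxHeartbeats 400000 in -- the extension/restriction bijection elaborates many `O(q_T)`-subtype terms; 200k fails, 400k passes
/-- **`{σ ∈ O(q_{h^⊥}) | σ|_{p(H)} = id} ≅ O(q_L)`** for `(h, h') = 1`, `(h,h) ≠ 0`, `L` even nondegenerate: along
`D(h^⊥) = p(H) ⊕ K` and the isometry `Φ : (D(L), q_L) ⥲ (K, q_{h^⊥}|_K)` (row g42-#6), `τ ↦ id_{p(H)} ⊕ Φ τ Φ⁻¹` is a
bijection with inverse `σ ↦ Φ⁻¹ σ|_K Φ` (`σ(K) = K`, §2). ("`{γ ∈ O(h_d^⊥) | γ̄|_{p(H)} = id}/Õ(h_d^⊥) ≅ O(⟨k̄₃⟩)`",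
`⟨k̄₃⟩ ≅ D(L_{2t})`.) [cite: GritsenkoHulekSankaran2010Symplectic, §4 proof of Prop. 4.12 (ii)] -/
theorem natCard_discriminantIsometry_apply_toDiscriminantGroup_eq_eq_of_apply_eq_one (hBn : B.Nondegenerate)
    (hB : B.IsSymm) (he : B.IsEven) {h h' : M} (hh : B h h ≠ 0) (hh' : B h h' = 1) :
    Nat.card {σ : (B.restrict (B.orthogonal (ℤ ∙ h))).discriminantGroup ≃ₗ[ℤ]
        (B.restrict (B.orthogonal (ℤ ∙ h))).discriminantGroup //
        (∀ a, (B.restrict (B.orthogonal (ℤ ∙ h))).discriminantQuad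
            (B.nondegenerate_restrict_orthogonal_span_singleton hBn hB hh) (hB.restrict _) (isEven_restrict he _) (σ a) =
          (B.restrict (B.orthogonal (ℤ ∙ h))).discriminantQuad
            (B.nondegenerate_restrict_orthogonal_span_singleton hBn hB hh) (hB.restrict _) (isEven_restrict he _) a) ∧
          ∀ x : M, σ (B.toDiscriminantGroup (B.orthogonal (ℤ ∙ h)) x) = B.toDiscriminantGroup (B.orthogonal (ℤ ∙ h)) x} =
      Nat.card {τ : B.discriminantGroup ≃ₗ[ℤ] B.discriminantGroup //
        ∀ b, B.discriminantQuad hBn hB he (τ b) = B.discriminantQuad hBn hB he b} := by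
  -- notation-free abbreviations, as hypotheses
  have hc := B.isCompl_range_toDiscriminantGroup_of_apply_eq_one hB hh'
  obtain ⟨Φ, hΦi, hΦr, hΦmk⟩ := B.exists_linearMap_discriminantGroup_injective_range_eq_of_apply_eq_one hB hh'
  -- `q_T ∘ Φ = q_L`
  have hΦq : ∀ y, (B.restrict (B.orthogonal (ℤ ∙ h))).discriminantQuad
      (B.nondegenerate_restrict_orthogonal_span_singleton hBn hB hh) (hB.restrict _) (isEven_restrict he _) (Φ y) =
        B.discriminantQuad hBn hB he y := fun y ↦ by
    obtain ⟨ψ, rfl⟩ := B.discriminantGroup_mk_surjective y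
    rw [hΦmk]
    exact B.discriminantQuad_mk_dualMap_subtype_sub_of_apply_eq_one hBn hB he hh hh' ψ
  have hΦK : ∀ y, Φ y ∈ (LinearMap.ker (Module.Dual.eval ℤ M h)).map
      ((B.restrict (B.orthogonal (ℤ ∙ h))).discriminantGroupMkQ ∘ₗ (B.orthogonal (ℤ ∙ h)).subtype.dualMap) :=
    fun y ↦ hΦr ▸ LinearMap.mem_range_self Φ y
  -- `Φ` as an isomorphism onto `K`
  obtain ⟨ΦK, hΦK_apply⟩ : ∃ ΦK : B.discriminantGroup ≃ₗ[ℤ] (LinearMap.ker (Module.Dual.eval ℤ M h)).map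
      ((B.restrict (B.orthogonal (ℤ ∙ h))).discriminantGroupMkQ ∘ₗ (B.orthogonal (ℤ ∙ h)).subtype.dualMap),
      ∀ y, (ΦK y : (B.restrict (B.orthogonal (ℤ ∙ h))).discriminantGroup) = Φ y :=
    ⟨(LinearEquiv.ofInjective Φ hΦi).trans (LinearEquiv.ofEq _ _ hΦr), fun _ ↦ rfl⟩
  have hΦK_symm : ∀ k, Φ (ΦK.symm k) = k := fun k ↦ by rw [← hΦK_apply, LinearEquiv.apply_symm_apply]
  -- `D(T) = p(H) ⊕ K`
  obtain ⟨e, he'⟩ : ∃ e : (LinearMap.range (B.toDiscriminantGroup (B.orthogonal (ℤ ∙ h))) ×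
      (LinearMap.ker (Module.Dual.eval ℤ M h)).map
        ((B.restrict (B.orthogonal (ℤ ∙ h))).discriminantGroupMkQ ∘ₗ (B.orthogonal (ℤ ∙ h)).subtype.dualMap)) ≃ₗ[ℤ]
        (B.restrict (B.orthogonal (ℤ ∙ h))).discriminantGroup,
      ∀ a k, e (a, k) = (a : (B.restrict (B.orthogonal (ℤ ∙ h))).discriminantGroup) + k :=
    ⟨Submodule.prodEquivOfIsCompl _ _ hc, fun _ _ ↦ rfl⟩
  -- extension `τ ↦ id ⊕ Φ τ Φ⁻¹`
  have key₁ : ∀ τ : B.discriminantGroup ≃ₗ[ℤ] B.discriminantGroup,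
      ∃ σ : (B.restrict (B.orthogonal (ℤ ∙ h))).discriminantGroup ≃ₗ[ℤ]
        (B.restrict (B.orthogonal (ℤ ∙ h))).discriminantGroup,
        ∀ a k, σ (e (a, k)) = (a : (B.restrict (B.orthogonal (ℤ ∙ h))).discriminantGroup) + Φ (τ (ΦK.symm k)) :=
    fun τ ↦ ⟨(e.symm.trans ((LinearEquiv.refl ℤ _).prodCongr ((ΦK.symm.trans τ).trans ΦK))).trans e, fun a k ↦ by
      rw [LinearEquiv.trans_apply, LinearEquiv.trans_apply, LinearEquiv.symm_apply_apply, LinearEquiv.prodCongr_apply,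
        he', LinearEquiv.refl_apply, LinearEquiv.trans_apply, LinearEquiv.trans_apply, hΦK_apply]⟩
  choose ext hext using key₁
  -- `ext τ` preserves `q_T`
  have hextq : ∀ τ : B.discriminantGroup ≃ₗ[ℤ] B.discriminantGroup,
      (∀ b, B.discriminantQuad hBn hB he (τ b) = B.discriminantQuad hBn hB he b) →
      ∀ a, (B.restrict (B.orthogonal (ℤ ∙ h))).discriminantQuad
          (B.nondegenerate_restrict_orthogonal_span_singleton hBn hB hh) (hB.restrict _) (isEven_restrict he _) (ext τ a) =
        (B.restrict (B.orthogonal (ℤ ∙ h))).discriminantQuad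
          (B.nondegenerate_restrict_orthogonal_span_singleton hBn hB hh) (hB.restrict _) (isEven_restrict he _) a := by
    intro τ hτ x
    obtain ⟨⟨a, k⟩, rfl⟩ := e.surjective x
    rw [hext, he', B.discriminantQuad_add_of_mem_range_toDiscriminantGroup_of_mem hBn hB he hh a.2 (hΦK _),
      B.discriminantQuad_add_of_mem_range_toDiscriminantGroup_of_mem hBn hB he hh a.2 k.2, hΦq, hτ, ← hΦq, hΦK_symm]
  -- `ext τ` fixes `p(H)` pointwise
  have hextp : ∀ (τ : B.discriminantGroup ≃ₗ[ℤ] B.discriminantGroup) (x : M),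
      ext τ (B.toDiscriminantGroup (B.orthogonal (ℤ ∙ h)) x) = B.toDiscriminantGroup (B.orthogonal (ℤ ∙ h)) x := by
    intro τ x
    have hx : B.toDiscriminantGroup (B.orthogonal (ℤ ∙ h)) x =
        e (⟨B.toDiscriminantGroup (B.orthogonal (ℤ ∙ h)) x, LinearMap.mem_range_self _ x⟩, 0) := by
      rw [he', Submodule.coe_zero, add_zero]
    rw [hx, hext, map_zero, map_zero, map_zero, add_zero, he', Submodule.coe_zero, add_zero]
  -- restriction `σ ↦ Φ⁻¹ σ|_K Φ`
  have key₂ : ∀ σ : {σ : (B.restrict (B.orthogonal (ℤ ∙ h))).discriminantGroup ≃ₗ[ℤ]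
        (B.restrict (B.orthogonal (ℤ ∙ h))).discriminantGroup //
        (∀ a, (B.restrict (B.orthogonal (ℤ ∙ h))).discriminantQuad
            (B.nondegenerate_restrict_orthogonal_span_singleton hBn hB hh) (hB.restrict _) (isEven_restrict he _) (σ a) =
          (B.restrict (B.orthogonal (ℤ ∙ h))).discriminantQuad
            (B.nondegenerate_restrict_orthogonal_span_singleton hBn hB hh) (hB.restrict _) (isEven_restrict he _) a) ∧
          ∀ x : M, σ (B.toDiscriminantGroup (B.orthogonal (ℤ ∙ h)) x) = B.toDiscriminantGroup (B.orthogonal (ℤ ∙ h)) x},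
      ∃ τ : B.discriminantGroup ≃ₗ[ℤ] B.discriminantGroup, ∀ y, Φ (τ y) = σ.1 (Φ y) := fun σ ↦
    ⟨(ΦK.trans (σ.1.ofSubmodules _ _
        (B.map_eq_of_forall_discriminantQuad_eq_of_forall_apply_toDiscriminantGroup_eq hBn hB he hh hh' σ.1 σ.2.1 σ.2.2))).trans
      ΦK.symm, fun y ↦ by
      rw [LinearEquiv.trans_apply, LinearEquiv.trans_apply, hΦK_symm, LinearEquiv.ofSubmodules_apply, hΦK_apply]⟩
  choose res hres using key₂
  -- `res σ` preserves `q_L`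
  have hresq : ∀ σ b, B.discriminantQuad hBn hB he (res σ b) = B.discriminantQuad hBn hB he b := fun σ b ↦ by
    rw [← hΦq, hres, σ.2.1, hΦq]
  refine Nat.card_congr
    { toFun := fun σ ↦ ⟨res σ, hresq σ⟩
      invFun := fun τ ↦ ⟨ext τ.1, hextq τ.1 τ.2, hextp τ.1⟩
      left_inv := fun σ ↦ Subtype.ext (LinearEquiv.ext fun x ↦ ?_)
      right_inv := fun τ ↦ Subtype.ext (LinearEquiv.ext fun y ↦ ?_) }
  · -- `ext (res σ) = σ`
    obtain ⟨⟨a, k⟩, rfl⟩ := e.surjective x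
    obtain ⟨x₀, hx₀⟩ := a.2
    change ext (res σ) (e (a, k)) = σ.1 (e (a, k))
    rw [hext, hres, hΦK_symm, he', map_add, ← hx₀, σ.2.2]
  · -- `res (ext τ) = τ`
    apply hΦi
    change Φ (res ⟨ext τ.1, hextq τ.1 τ.2, hextp τ.1⟩ y) = Φ (τ.1 y)
    have hy : (ΦK y : (B.restrict (B.orthogonal (ℤ ∙ h))).discriminantGroup) = e (0, ΦK y) := by
      rw [he', Submodule.coe_zero, zero_add]
    rw [hres, ← hΦK_apply y, hy]
    change ext τ.1 (e (0, ΦK y)) = Φ (τ.1 y)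
    rw [hext, Submodule.coe_zero, zero_add, LinearEquiv.symm_apply_apply]

/-- **GHS Prop. 4.12 (ii) for `f = 1`, lattice-free: `|{γ ∈ O(h^⊥) | γ̄|_{p(H)} = id} / (γ̄ = γ̄')| = |O(q_L)|`** when
`(h, h') = 1`, `(h,h) ≠ 0`, `L` even nondegenerate and every isometry of `q_{h^⊥}` lifts to `O(h^⊥)` ("the natural
projection `O(h_d^⊥) → O(D(L_B))` is surjective (see [Nik])"). The classes `γ̄ = γ̄'` are the cosets of
`Õ(h^⊥) ≅ Õ(L, h)` (Prop. 4.12 (i)). [cite: GritsenkoHulekSankaran2010Symplectic, §4 Prop. 4.12 (ii)] [cite: GritsenkoHulekSankaran2013ModuliK3, §7 Lemma 7.3 (iv)] -/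
theorem natCard_quot_isometryEquiv_toDiscriminantGroup_eq_of_apply_eq_one (hBn : B.Nondegenerate) (hB : B.IsSymm)
    (he : B.IsEven) {h h' : M} (hh : B h h ≠ 0) (hh' : B h h' = 1)
    (hsurj : ∀ σ : (B.restrict (B.orthogonal (ℤ ∙ h))).discriminantGroup ≃ₗ[ℤ]
        (B.restrict (B.orthogonal (ℤ ∙ h))).discriminantGroup,
      (∀ a, (B.restrict (B.orthogonal (ℤ ∙ h))).discriminantQuad
          (B.nondegenerate_restrict_orthogonal_span_singleton hBn hB hh) (hB.restrict _) (isEven_restrict he _) (σ a) =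
        (B.restrict (B.orthogonal (ℤ ∙ h))).discriminantQuad
          (B.nondegenerate_restrict_orthogonal_span_singleton hBn hB hh) (hB.restrict _) (isEven_restrict he _) a) →
        ∃ γ : (B.restrict (B.orthogonal (ℤ ∙ h))).IsometryEquiv (B.restrict (B.orthogonal (ℤ ∙ h))),
          γ.discriminantGroupCongr = σ) :
    Nat.card (Quot fun γ γ' : {γ : (B.restrict (B.orthogonal (ℤ ∙ h))).IsometryEquiv (B.restrict (B.orthogonal (ℤ ∙ h))) //
        ∀ x : M, γ.discriminantGroupCongr (B.toDiscriminantGroup (B.orthogonal (ℤ ∙ h)) x) =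
          B.toDiscriminantGroup (B.orthogonal (ℤ ∙ h)) x} ↦
          γ.1.discriminantGroupCongr = γ'.1.discriminantGroupCongr) =
      Nat.card {τ : B.discriminantGroup ≃ₗ[ℤ] B.discriminantGroup //
        ∀ b, B.discriminantQuad hBn hB he (τ b) = B.discriminantQuad hBn hB he b} := by
  rw [B.natCard_quot_setOf_discriminantGroupCongr_toDiscriminantGroup_eq (B.orthogonal (ℤ ∙ h))
    (B.nondegenerate_restrict_orthogonal_span_singleton hBn hB hh) (hB.restrict _) (isEven_restrict he _) hsurj]
  exact B.natCard_discriminantIsometry_apply_toDiscriminantGroup_eq_eq_of_apply_eq_one hBn hB he hh hh'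

/-- **`|O(L, h)|_{h^⊥} / Õ| = |O(q_L)|`** — the same count with the classes indexed by the restrictions of the stabiliser
`O(L, h) = {G ∈ O(L) | G h = h}` to `h^⊥` (Lemma 4.2: `{γ ∈ O(h^⊥) | γ̄|_{p(H)} = id} = O(L,h)|_{h^⊥}`), two restrictions
being identified when they induce the same isometry of `q_{h^⊥}`, i.e. differ by `Õ(h^⊥) ≅ Õ(L,h)`.
[cite: GritsenkoHulekSankaran2010Symplectic, §4 Prop. 4.12 (ii) ("`O(L_{2t}, h_d)/Õ(L_{2t}, h_d) ≅ … ≅ O(⟨k̄₃⟩)`")] -/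
theorem natCard_quot_exists_isometryEquiv_apply_eq_of_apply_eq_one (hBn : B.Nondegenerate) (hB : B.IsSymm)
    (he : B.IsEven) {h h' : M} (hh : B h h ≠ 0) (hh' : B h h' = 1)
    (hsurj : ∀ σ : (B.restrict (B.orthogonal (ℤ ∙ h))).discriminantGroup ≃ₗ[ℤ]
        (B.restrict (B.orthogonal (ℤ ∙ h))).discriminantGroup,
      (∀ a, (B.restrict (B.orthogonal (ℤ ∙ h))).discriminantQuad
          (B.nondegenerate_restrict_orthogonal_span_singleton hBn hB hh) (hB.restrict _) (isEven_restrict he _) (σ a) =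
        (B.restrict (B.orthogonal (ℤ ∙ h))).discriminantQuad
          (B.nondegenerate_restrict_orthogonal_span_singleton hBn hB hh) (hB.restrict _) (isEven_restrict he _) a) →
        ∃ γ : (B.restrict (B.orthogonal (ℤ ∙ h))).IsometryEquiv (B.restrict (B.orthogonal (ℤ ∙ h))),
          γ.discriminantGroupCongr = σ) :
    Nat.card (Quot fun γ γ' : {γ : (B.restrict (B.orthogonal (ℤ ∙ h))).IsometryEquiv (B.restrict (B.orthogonal (ℤ ∙ h))) //
        ∃ G : B.IsometryEquiv B, G h = h ∧ ∀ n : B.orthogonal (ℤ ∙ h), G n = γ n} ↦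
          γ.1.discriminantGroupCongr = γ'.1.discriminantGroupCongr) =
      Nat.card {τ : B.discriminantGroup ≃ₗ[ℤ] B.discriminantGroup //
        ∀ b, B.discriminantQuad hBn hB he (τ b) = B.discriminantQuad hBn hB he b} := by
  rw [← B.natCard_quot_isometryEquiv_toDiscriminantGroup_eq_of_apply_eq_one hBn hB he hh hh' hsurj]
  have hiff : ∀ γ : (B.restrict (B.orthogonal (ℤ ∙ h))).IsometryEquiv (B.restrict (B.orthogonal (ℤ ∙ h))),
      (∃ G : B.IsometryEquiv B, G h = h ∧ ∀ n : B.orthogonal (ℤ ∙ h), G n = γ n) ↔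
        ∀ x : M, γ.discriminantGroupCongr (B.toDiscriminantGroup (B.orthogonal (ℤ ∙ h)) x) =
          B.toDiscriminantGroup (B.orthogonal (ℤ ∙ h)) x := fun γ ↦
    (Set.ext_iff.1 (B.setOf_discriminantGroupCongr_toDiscriminantGroup_eq_eq_setOf_exists_apply_eq hBn hB hh) γ).symm
  exact Nat.card_congr (Quot.congr (Equiv.subtypeEquivRight hiff) fun _ _ ↦ Iff.rfl)

/-- **Prop. 4.12 (ii), `f = 1`, with Nikulin's lifting built in**: if moreover `h^⊥` contains an isotropic vector `u` and a
`v` with `(u, v) = 1` (e.g. a hyperbolic plane, as `(h_d)^⊥_{L_{2t}} ≅ 2U ⊕ …` does), then `O(h^⊥) → O(q_{h^⊥})` is onto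
(Nikulin 1.14.2) and `|O(L, h)|_{h^⊥} / Õ| = |O(q_L)|`. [cite: GritsenkoHulekSankaran2010Symplectic, §4 Prop. 4.12 (ii)] [cite: Nikulin1980, Thm. 1.14.2] -/
theorem natCard_quot_exists_isometryEquiv_apply_eq_of_apply_eq_one_of_isotropic (hBn : B.Nondegenerate)
    (hB : B.IsSymm) (he : B.IsEven) {h h' : M} (hh : B h h ≠ 0) (hh' : B h h' = 1) {u v : M}
    (hu : u ∈ B.orthogonal (ℤ ∙ h)) (hv : v ∈ B.orthogonal (ℤ ∙ h)) (huu : B u u = 0) (huv : B u v = 1) :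
    Nat.card (Quot fun γ γ' : {γ : (B.restrict (B.orthogonal (ℤ ∙ h))).IsometryEquiv (B.restrict (B.orthogonal (ℤ ∙ h))) //
        ∃ G : B.IsometryEquiv B, G h = h ∧ ∀ n : B.orthogonal (ℤ ∙ h), G n = γ n} ↦
          γ.1.discriminantGroupCongr = γ'.1.discriminantGroupCongr) =
      Nat.card {τ : B.discriminantGroup ≃ₗ[ℤ] B.discriminantGroup //
        ∀ b, B.discriminantQuad hBn hB he (τ b) = B.discriminantQuad hBn hB he b} := by
  refine B.natCard_quot_exists_isometryEquiv_apply_eq_of_apply_eq_one hBn hB he hh hh' fun σ hσ ↦ ?_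
  obtain ⟨γ, hγ⟩ := exists_isometryEquiv_discriminantGroupCongr_eq_of_isotropic (B.restrict (B.orthogonal (ℤ ∙ h)))
    (B.nondegenerate_restrict_orthogonal_span_singleton hBn hB hh) (hB.restrict _) (isEven_restrict he _)
    (x := ⟨u, hu⟩) (y := ⟨v, hv⟩) huu huv σ hσ
  exact ⟨γ, LinearEquiv.ext hγ⟩

end Count

end LinearMap.BilinForm

/-! ### §4 The rank-21 model `2E₈(−1) ⊕ 2U ⊕ ⟨−2t⟩` (GHS 2007's `L_{2t}`, the tree's `latticeL2d`): the count `2^{ρ(t)}`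
for the split `h_d = e₁ + d f₁` -/

namespace Literature.Topology.FourManifolds

open LinearMap.BilinForm

/-- In `2E₈(−1) ⊕ 2U ⊕ ⟨−2t⟩` (GHS 2007's `L_{2t}`; for GHS 2010's rank-23 `L_{2t}` see §5) the split vector
`h_d = e₁ + d f₁` of the first hyperbolic plane has `h_d² = 2d`, `(h_d, f₁) = 1` (so `div(h_d) = 1`), and the second hyperbolic
plane `⟨e₂, f₂⟩` lies in `h_d^⊥`: `e₂² = 0`, `(e₂, f₂) = 1`, `(h_d, e₂) = (h_d, f₂) = 0`.
[cite: GritsenkoHulekSankaran2010Symplectic, §4 Example 4.8 (`f = 1`)] [cite: GritsenkoHulekSankaran2007HM, §4 ("`L_{2d} = ⟨−2d⟩ ⊕ 2U ⊕ 2E₈(−1)`")] -/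
theorem latticeL2t_split_polarisation_apply (t : ℕ) (d : ℤ) :
    (((LinearMap.BilinForm.pi fun _ : Fin 2 ↦ -e8Form).prod (hyperbolicSum 2)).prod ((-(2 * t : ℤ)) • LinearMap.mul ℤ ℤ))
          ((0, (Pi.single 0 1, d • Pi.single 0 1)), 0) ((0, (Pi.single 0 1, d • Pi.single 0 1)), 0) = 2 * d ∧
      (((LinearMap.BilinForm.pi fun _ : Fin 2 ↦ -e8Form).prod (hyperbolicSum 2)).prod ((-(2 * t : ℤ)) • LinearMap.mul ℤ ℤ))
          ((0, (Pi.single 0 1, d • Pi.single 0 1)), 0) ((0, (0, Pi.single 0 1)), 0) = 1 ∧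
      (((LinearMap.BilinForm.pi fun _ : Fin 2 ↦ -e8Form).prod (hyperbolicSum 2)).prod ((-(2 * t : ℤ)) • LinearMap.mul ℤ ℤ))
          ((0, (Pi.single 1 1, 0)), 0) ((0, (Pi.single 1 1, 0)), 0) = 0 ∧
      (((LinearMap.BilinForm.pi fun _ : Fin 2 ↦ -e8Form).prod (hyperbolicSum 2)).prod ((-(2 * t : ℤ)) • LinearMap.mul ℤ ℤ))
          ((0, (Pi.single 1 1, 0)), 0) ((0, (0, Pi.single 1 1)), 0) = 1 ∧
      (((LinearMap.BilinForm.pi fun _ : Fin 2 ↦ -e8Form).prod (hyperbolicSum 2)).prod ((-(2 * t : ℤ)) • LinearMap.mul ℤ ℤ))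
          ((0, (Pi.single 0 1, d • Pi.single 0 1)), 0) ((0, (Pi.single 1 1, 0)), 0) = 0 ∧
      (((LinearMap.BilinForm.pi fun _ : Fin 2 ↦ -e8Form).prod (hyperbolicSum 2)).prod ((-(2 * t : ℤ)) • LinearMap.mul ℤ ℤ))
          ((0, (Pi.single 0 1, d • Pi.single 0 1)), 0) ((0, (0, Pi.single 1 1)), 0) = 0 := by
  refine ⟨?_, ?_, ?_, ?_, ?_, ?_⟩ <;> simp [LinearMap.BilinForm.prod_apply, two_mul]

/-- **Prop. 4.12 (ii)'s count for the rank-21 model and a split polarisation**: for `h_d = e₁ + d f₁ ∈ L = 2E₈(−1) ⊕ 2U ⊕ ⟨−2t⟩`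
(GHS 2007's `L_{2t}`; `d ≠ 0`, `t ≥ 1`) the restrictions of the stabiliser `O(L, h_d)` to `h_d^⊥`, modulo those inducing the
same isometry of `q_{h_d^⊥}` (i.e. modulo `Õ(h_d^⊥) ≅ Õ(L, h_d)`), number **`|O(q_L)| = 2^{ρ(t)}`** ("The factor group
`O(L_{2t}, h_d)/Õ(L_{2t}, h_d)` is … of order `2^{ρ(t/f)}` if `f` is odd", `f = 1`; GHS 2010's own `L_{2t}` has one more `U`,
§5, same count). [cite: GritsenkoHulekSankaran2010Symplectic, §4 Prop. 4.12 (ii)] [cite: GritsenkoHulekSankaran2007HM, §4 Lemma 4.3 (`|O(q_{L_{2t}})| = 2^{ρ(t)}`)] -/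
theorem natCard_quot_exists_isometryEquiv_apply_eq_latticeL2t_split {t : ℕ} (ht : 0 < t) {d : ℤ} (hd : d ≠ 0)
    (h₁ : (((LinearMap.BilinForm.pi fun _ : Fin 2 ↦ -e8Form).prod (hyperbolicSum 2)).prod
        ((-(2 * t : ℤ)) • LinearMap.mul ℤ ℤ)).Nondegenerate)
    (h₂ : (((LinearMap.BilinForm.pi fun _ : Fin 2 ↦ -e8Form).prod (hyperbolicSum 2)).prod
        ((-(2 * t : ℤ)) • LinearMap.mul ℤ ℤ)).IsSymm)
    (h₃ : (((LinearMap.BilinForm.pi fun _ : Fin 2 ↦ -e8Form).prod (hyperbolicSum 2)).prod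
        ((-(2 * t : ℤ)) • LinearMap.mul ℤ ℤ)).IsEven) :
    Nat.card (Quot fun γ γ' : {γ : ((((LinearMap.BilinForm.pi fun _ : Fin 2 ↦ -e8Form).prod (hyperbolicSum 2)).prod
          ((-(2 * t : ℤ)) • LinearMap.mul ℤ ℤ)).restrict
          ((((LinearMap.BilinForm.pi fun _ : Fin 2 ↦ -e8Form).prod (hyperbolicSum 2)).prod
            ((-(2 * t : ℤ)) • LinearMap.mul ℤ ℤ)).orthogonal
            (ℤ ∙ (((0 : Fin 2 → Fin 8 → ℤ), ((Pi.single 0 1 : Fin 2 → ℤ), d • (Pi.single 0 1 : Fin 2 → ℤ))), (0 : ℤ))))).IsometryEquiv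
          ((((LinearMap.BilinForm.pi fun _ : Fin 2 ↦ -e8Form).prod (hyperbolicSum 2)).prod
            ((-(2 * t : ℤ)) • LinearMap.mul ℤ ℤ)).restrict
            ((((LinearMap.BilinForm.pi fun _ : Fin 2 ↦ -e8Form).prod (hyperbolicSum 2)).prod
              ((-(2 * t : ℤ)) • LinearMap.mul ℤ ℤ)).orthogonal
              (ℤ ∙ (((0 : Fin 2 → Fin 8 → ℤ), ((Pi.single 0 1 : Fin 2 → ℤ), d • (Pi.single 0 1 : Fin 2 → ℤ))), (0 : ℤ))))) //
        ∃ G : (((LinearMap.BilinForm.pi fun _ : Fin 2 ↦ -e8Form).prod (hyperbolicSum 2)).prod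
            ((-(2 * t : ℤ)) • LinearMap.mul ℤ ℤ)).IsometryEquiv
            (((LinearMap.BilinForm.pi fun _ : Fin 2 ↦ -e8Form).prod (hyperbolicSum 2)).prod
              ((-(2 * t : ℤ)) • LinearMap.mul ℤ ℤ)),
          G (((0 : Fin 2 → Fin 8 → ℤ), ((Pi.single 0 1 : Fin 2 → ℤ), d • (Pi.single 0 1 : Fin 2 → ℤ))), (0 : ℤ)) =
              (((0 : Fin 2 → Fin 8 → ℤ), ((Pi.single 0 1 : Fin 2 → ℤ), d • (Pi.single 0 1 : Fin 2 → ℤ))), (0 : ℤ)) ∧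
            ∀ n : (((LinearMap.BilinForm.pi fun _ : Fin 2 ↦ -e8Form).prod (hyperbolicSum 2)).prod
                ((-(2 * t : ℤ)) • LinearMap.mul ℤ ℤ)).orthogonal
                (ℤ ∙ (((0 : Fin 2 → Fin 8 → ℤ), ((Pi.single 0 1 : Fin 2 → ℤ), d • (Pi.single 0 1 : Fin 2 → ℤ))), (0 : ℤ))),
              G n = γ n} ↦
        γ.1.discriminantGroupCongr = γ'.1.discriminantGroupCongr) = 2 ^ t.primeFactors.card := by
  obtain ⟨hh, hh', huu, huv, hhu, hhv⟩ := latticeL2t_split_polarisation_apply t d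
  have hh0 : (((LinearMap.BilinForm.pi fun _ : Fin 2 ↦ -e8Form).prod (hyperbolicSum 2)).prod
      ((-(2 * t : ℤ)) • LinearMap.mul ℤ ℤ)) ((0, (Pi.single 0 1, d • Pi.single 0 1)), 0)
      ((0, (Pi.single 0 1, d • Pi.single 0 1)), 0) ≠ 0 := by
    rw [hh]
    exact mul_ne_zero two_ne_zero hd
  rw [LinearMap.BilinForm.natCard_quot_exists_isometryEquiv_apply_eq_of_apply_eq_one_of_isotropic _ h₁ h₂ h₃ hh0 hh'
    ((LinearMap.BilinForm.mem_orthogonal_span_singleton_iff _).2 hhu)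
    ((LinearMap.BilinForm.mem_orthogonal_span_singleton_iff _).2 hhv) huu huv]
  exact natCard_discriminantIsometry_latticeL2d t ht h₁ h₂ h₃

/-! ### §5 Every model `Q ⊕ ⟨−2t⟩`, `Q` even unimodular — in particular GHS 2010's `L_{2t} = L_{K3} ⊕ ⟨−2t⟩ =
2E₈(−1) ⊕ 3U ⊕ ⟨−2t⟩`: `|O(q)| = 2^{ρ(t)}` and the split count -/

/-- **`|O(q_{Q ⊕ ⟨−2t⟩})| = |O(q_{⟨−2t⟩})| = 2^{ρ(t)}`** for every even unimodular `Q` (`t ≥ 1`): `(A_{Q ⊕ R}, q) ≅ (A_R, q_R)`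
(`A_Q = 0`) and GHS 2007 Lemma 4.3. For `Q = L_{K3} = 3U ⊕ 2E₈(−1)` this is `|O(D(L_{2t}))| = 2^{ρ(t)}` for GHS 2010's `L_{2t}`.
[cite: GritsenkoHulekSankaran2007HM, §4 Lemma 4.3] [cite: GritsenkoHulekSankaran2010Symplectic, §4 Prop. 4.12 (ii) (the order `2^{ρ(t)}`)] [cite: Nikulin1980, §1.3] -/
theorem natCard_discriminantIsometry_prod_neg_twoMul_smul_mul_of_isUnimodular {X : Type*} [AddCommGroup X]
    [Module.Finite ℤ X] [Module.Free ℤ X] (Q : BilinForm ℤ X) (hQs : Q.IsSymm) (hQu : Q.IsUnimodular) (hQe : Q.IsEven)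
    {t : ℕ} (ht : 0 < t) (h₁ : (Q.prod ((-(2 * t : ℤ)) • LinearMap.mul ℤ ℤ)).Nondegenerate)
    (h₂ : (Q.prod ((-(2 * t : ℤ)) • LinearMap.mul ℤ ℤ)).IsSymm) (h₃ : (Q.prod ((-(2 * t : ℤ)) • LinearMap.mul ℤ ℤ)).IsEven) :
    Nat.card {σ : (Q.prod ((-(2 * t : ℤ)) • LinearMap.mul ℤ ℤ)).discriminantGroup ≃ₗ[ℤ]
        (Q.prod ((-(2 * t : ℤ)) • LinearMap.mul ℤ ℤ)).discriminantGroup //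
        ∀ a, (Q.prod ((-(2 * t : ℤ)) • LinearMap.mul ℤ ℤ)).discriminantQuad h₁ h₂ h₃ (σ a) =
          (Q.prod ((-(2 * t : ℤ)) • LinearMap.mul ℤ ℤ)).discriminantQuad h₁ h₂ h₃ a} = 2 ^ t.primeFactors.card := by
  obtain ⟨hR, hsR, heR⟩ := nondegenerate_isSymm_isEven_neg_twoMul_smul_mul t ht
  have h₁' : (LinearMap.BilinForm.prod ((-(2 * t : ℤ)) • LinearMap.mul ℤ ℤ) Q).Nondegenerate := hR.prod hQu.nondegenerate
  have h₂' : (LinearMap.BilinForm.prod ((-(2 * t : ℤ)) • LinearMap.mul ℤ ℤ) Q).IsSymm := hsR.prod hQs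
  have h₃' : (LinearMap.BilinForm.prod ((-(2 * t : ℤ)) • LinearMap.mul ℤ ℤ) Q).IsEven := isEven_prod_iff.2 ⟨heR, hQe⟩
  obtain ⟨φ, hφ⟩ := exists_discriminantQuad_iso_prod_of_isUnimodular ((-(2 * t : ℤ)) • LinearMap.mul ℤ ℤ) Q hR hsR heR
    hQs hQu hQe
  rw [natCard_discriminantIsometry_eq_of_isometryEquiv _ _ (IsometryEquiv.prodComm Q ((-(2 * t : ℤ)) • LinearMap.mul ℤ ℤ))
      h₁ h₂ h₃ h₁' h₂' h₃',
    ← natCard_discriminantIsometry_eq_of_discriminantIsometry _ _ hR hsR heR h₁' h₂' h₃' φ hφ]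
  exact natCard_discriminantIsometry_neg_twoMul_smul_mul t ht hR hsR heR

/-- The split vector `h_d = e₁ + d f₁ ∈ E₈(−1)^{⊕m} ⊕ U^{⊕(k+2)} ⊕ ⟨−2t⟩` (in the first hyperbolic plane): `h_d² = 2d`,
`(h_d, f₁) = 1`, and the second hyperbolic plane `⟨e₂, f₂⟩ ⊂ h_d^⊥` with `e₂² = 0`, `(e₂, f₂) = 1`.
[cite: GritsenkoHulekSankaran2010Symplectic, §4 Example 4.8 (`f = 1`), with `L_{2t} = 3U ⊕ 2E₈(−1) ⊕ ⟨−2t⟩` (`m = 2`, `k = 1`)] -/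
theorem model_split_polarisation_apply (m k t : ℕ) (d : ℤ) :
    (((LinearMap.BilinForm.pi fun _ : Fin m ↦ -e8Form).prod (hyperbolicSum (k + 2))).prod ((-(2 * t : ℤ)) • LinearMap.mul ℤ ℤ))
          ((0, (Pi.single 0 1, d • Pi.single 0 1)), 0) ((0, (Pi.single 0 1, d • Pi.single 0 1)), 0) = 2 * d ∧
      (((LinearMap.BilinForm.pi fun _ : Fin m ↦ -e8Form).prod (hyperbolicSum (k + 2))).prod ((-(2 * t : ℤ)) • LinearMap.mul ℤ ℤ))
          ((0, (Pi.single 0 1, d • Pi.single 0 1)), 0) ((0, (0, Pi.single 0 1)), 0) = 1 ∧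
      (((LinearMap.BilinForm.pi fun _ : Fin m ↦ -e8Form).prod (hyperbolicSum (k + 2))).prod ((-(2 * t : ℤ)) • LinearMap.mul ℤ ℤ))
          ((0, (Pi.single 1 1, 0)), 0) ((0, (Pi.single 1 1, 0)), 0) = 0 ∧
      (((LinearMap.BilinForm.pi fun _ : Fin m ↦ -e8Form).prod (hyperbolicSum (k + 2))).prod ((-(2 * t : ℤ)) • LinearMap.mul ℤ ℤ))
          ((0, (Pi.single 1 1, 0)), 0) ((0, (0, Pi.single 1 1)), 0) = 1 ∧
      (((LinearMap.BilinForm.pi fun _ : Fin m ↦ -e8Form).prod (hyperbolicSum (k + 2))).prod ((-(2 * t : ℤ)) • LinearMap.mul ℤ ℤ))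
          ((0, (Pi.single 0 1, d • Pi.single 0 1)), 0) ((0, (Pi.single 1 1, 0)), 0) = 0 ∧
      (((LinearMap.BilinForm.pi fun _ : Fin m ↦ -e8Form).prod (hyperbolicSum (k + 2))).prod ((-(2 * t : ℤ)) • LinearMap.mul ℤ ℤ))
          ((0, (Pi.single 0 1, d • Pi.single 0 1)), 0) ((0, (0, Pi.single 1 1)), 0) = 0 := by
  refine ⟨?_, ?_, ?_, ?_, ?_, ?_⟩ <;> simp [LinearMap.BilinForm.prod_apply, two_mul]

/-- **GHS Prop. 4.12 (ii) for `f = 1` in the models `L = E₈(−1)^{⊕m} ⊕ U^{⊕(k+2)} ⊕ ⟨−2t⟩`** — GHS 2010's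
`L_{2t} = L_{K3} ⊕ ⟨−2t⟩ = 2E₈(−1) ⊕ 3U ⊕ ⟨−2t⟩` being `m = 2`, `k = 1` — and the split `h_d = e₁ + d f₁` (`d ≠ 0`, `t ≥ 1`):
the restrictions of `O(L, h_d)` to `h_d^⊥` modulo those acting alike on `D(h_d^⊥)` (i.e. modulo `Õ(h_d^⊥) ≅ Õ(L, h_d)`) number
**`2^{ρ(t)}`** ("The factor group `O(L_{2t}, h_d)/Õ(L_{2t}, h_d)` is an abelian `2`-group, which is of order `2^{ρ(t/f)}` if
`f` is odd"; here `f = 1`). [cite: GritsenkoHulekSankaran2010Symplectic, §4 Prop. 4.12 (ii)] [cite: GritsenkoHulekSankaran2007HM, §4 Lemma 4.3] -/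
theorem natCard_quot_exists_isometryEquiv_apply_eq_model_split (m k : ℕ) {t : ℕ} (ht : 0 < t) {d : ℤ} (hd : d ≠ 0)
    (h₁ : (((LinearMap.BilinForm.pi fun _ : Fin m ↦ -e8Form).prod (hyperbolicSum (k + 2))).prod
        ((-(2 * t : ℤ)) • LinearMap.mul ℤ ℤ)).Nondegenerate)
    (h₂ : (((LinearMap.BilinForm.pi fun _ : Fin m ↦ -e8Form).prod (hyperbolicSum (k + 2))).prod
        ((-(2 * t : ℤ)) • LinearMap.mul ℤ ℤ)).IsSymm)
    (h₃ : (((LinearMap.BilinForm.pi fun _ : Fin m ↦ -e8Form).prod (hyperbolicSum (k + 2))).prod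
        ((-(2 * t : ℤ)) • LinearMap.mul ℤ ℤ)).IsEven) :
    Nat.card (Quot fun γ γ' : {γ : ((((LinearMap.BilinForm.pi fun _ : Fin m ↦ -e8Form).prod (hyperbolicSum (k + 2))).prod
          ((-(2 * t : ℤ)) • LinearMap.mul ℤ ℤ)).restrict
          ((((LinearMap.BilinForm.pi fun _ : Fin m ↦ -e8Form).prod (hyperbolicSum (k + 2))).prod
            ((-(2 * t : ℤ)) • LinearMap.mul ℤ ℤ)).orthogonal
            (ℤ ∙ (((0 : Fin m → Fin 8 → ℤ), ((Pi.single 0 1 : Fin (k + 2) → ℤ), d • (Pi.single 0 1 : Fin (k + 2) → ℤ))),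
              (0 : ℤ))))).IsometryEquiv
          ((((LinearMap.BilinForm.pi fun _ : Fin m ↦ -e8Form).prod (hyperbolicSum (k + 2))).prod
            ((-(2 * t : ℤ)) • LinearMap.mul ℤ ℤ)).restrict
            ((((LinearMap.BilinForm.pi fun _ : Fin m ↦ -e8Form).prod (hyperbolicSum (k + 2))).prod
              ((-(2 * t : ℤ)) • LinearMap.mul ℤ ℤ)).orthogonal
              (ℤ ∙ (((0 : Fin m → Fin 8 → ℤ), ((Pi.single 0 1 : Fin (k + 2) → ℤ), d • (Pi.single 0 1 : Fin (k + 2) → ℤ))),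
                (0 : ℤ))))) //
        ∃ G : (((LinearMap.BilinForm.pi fun _ : Fin m ↦ -e8Form).prod (hyperbolicSum (k + 2))).prod
            ((-(2 * t : ℤ)) • LinearMap.mul ℤ ℤ)).IsometryEquiv
            (((LinearMap.BilinForm.pi fun _ : Fin m ↦ -e8Form).prod (hyperbolicSum (k + 2))).prod
              ((-(2 * t : ℤ)) • LinearMap.mul ℤ ℤ)),
          G (((0 : Fin m → Fin 8 → ℤ), ((Pi.single 0 1 : Fin (k + 2) → ℤ), d • (Pi.single 0 1 : Fin (k + 2) → ℤ))), (0 : ℤ)) =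
              (((0 : Fin m → Fin 8 → ℤ), ((Pi.single 0 1 : Fin (k + 2) → ℤ), d • (Pi.single 0 1 : Fin (k + 2) → ℤ))), (0 : ℤ)) ∧
            ∀ n : (((LinearMap.BilinForm.pi fun _ : Fin m ↦ -e8Form).prod (hyperbolicSum (k + 2))).prod
                ((-(2 * t : ℤ)) • LinearMap.mul ℤ ℤ)).orthogonal
                (ℤ ∙ (((0 : Fin m → Fin 8 → ℤ), ((Pi.single 0 1 : Fin (k + 2) → ℤ), d • (Pi.single 0 1 : Fin (k + 2) → ℤ))),
                  (0 : ℤ))),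
              G n = γ n} ↦
        γ.1.discriminantGroupCongr = γ'.1.discriminantGroupCongr) = 2 ^ t.primeFactors.card := by
  obtain ⟨hh, hh', huu, huv, hhu, hhv⟩ := model_split_polarisation_apply m k t d
  have hh0 : (((LinearMap.BilinForm.pi fun _ : Fin m ↦ -e8Form).prod (hyperbolicSum (k + 2))).prod
      ((-(2 * t : ℤ)) • LinearMap.mul ℤ ℤ)) ((0, (Pi.single 0 1, d • Pi.single 0 1)), 0)
      ((0, (Pi.single 0 1, d • Pi.single 0 1)), 0) ≠ 0 := by
    rw [hh]
    exact mul_ne_zero two_ne_zero hd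
  obtain ⟨hsP, heP, huP⟩ := isSymm_isEven_isUnimodular_pi_neg_e8Form (m := m)
  rw [LinearMap.BilinForm.natCard_quot_exists_isometryEquiv_apply_eq_of_apply_eq_one_of_isotropic _ h₁ h₂ h₃ hh0 hh'
    ((LinearMap.BilinForm.mem_orthogonal_span_singleton_iff _).2 hhu)
    ((LinearMap.BilinForm.mem_orthogonal_span_singleton_iff _).2 hhv) huu huv]
  exact natCard_discriminantIsometry_prod_neg_twoMul_smul_mul_of_isUnimodular _ (hsP.prod (isSymm_hyperbolicSum (k + 2)))
    (isUnimodular_prod_iff.2 ⟨huP, isUnimodular_hyperbolicSum (k + 2)⟩)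
    (isEven_prod_iff.2 ⟨heP, isEven_hyperbolicSum (k + 2)⟩) ht h₁ h₂ h₃

end Literature.Topology.FourManifolds
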